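import Literature.Probability.LatticeModels.RandomClusterConditionalDomination
import Literature.Probability.LatticeModels.RandomClusterFiniteVolumePressure
import Literature.Probability.LatticeModels.RandomClusterEmbedding
import Literature.Probability.LatticeModels.RandomClusterRegionToAnnulus
import Literature.Probability.LatticeModels.FKInterfacePairing
import Literature.Probability.LatticeModels.FKIsingBarObservable
import Literature.Probability.LatticeModels.FKIsingRSW
import HarnessLib

/-!
# From the bar domain to the free rectangle: `P_bar(x ↔ bar) ≤ 8 ∑_j φ⁰_R(x ↔ (c+j, N))`

Topic `Literature/Probability/LatticeModels`; the measure-theoretic half of the comparison in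
Duminil-Copin–Hongler–Nolin's Proposition 13 (arXiv:0912.4253 §4), between the critical FK-Ising
Dobrushin measure of the bar domain (`LatticeDobrushin.barDomain`, wired on the bar, free on the
rest of the ring: the law seen by the fermionic observable) and the critical FK-Ising measure with
free boundary conditions of the lattice rectangle `R = [0, W] × [0, N]` (`fkIsingFiniteMeasure
(rectangle W N) ∅`, the measure of `fkIsing_rsw`). Everything is PROVED (0 new facts).

* Generic random-cluster lemmas: `rcMeasure_real_inter_mem_le_fromEdgeSet` (Grimmett's Lemma
  4.14(b) summed over the conditioning: the configuration inside a region is dominated by the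
  wired measure of the region), `rcMeasure_real_wired_le_pow_mul_free` (the cost `q^{|B|-1}` of a
  wiring), `rcMeasure_real_edgeOpen_ge` (finite energy `φ(e open) ≥ p/(p + q(1-p))`),
  `rcMeasure_real_inter_edgeOpen_ge`, `rcMeasure_real_reachable_ge_of_walk`,
  `rcMeasure_real_reachable_ge_pow` (FKG along a path).
* The bar domain: `DiscreteDobrushin.interfaceGraph_adj_iff`, `exit_edge_barDomain`,
  `exists_reachable_topSite_of_openJoined` (an open path to the bar leaves `R` through one of the
  four sites `(c+j, N)` under it), `rcMeasure_openJoined_le_sum`,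
  `fkDobrushin_real_openJoined_eq` (the Dobrushin measure as the random-cluster measure of the
  interface graph), `edgeFinset_fromEdgeSet_regEdges` + `rcMeasure_regEdges_reachable_eq` (the
  region `R` of the interface graph is the lattice rectangle, `rcMeasure_real_map_of_wired`), and
  **`fkDobrushin_openJoined_le_sum_free`**.

## References

* H. Duminil-Copin, C. Hongler, P. Nolin, *Connection probabilities and RSW-type bounds for the
  two-dimensional FK Ising model*, Comm. Pure Appl. Math. 64 (2011), §4 (Proposition 13) — bib
  key `DuminilCopinHonglerNolin2011`.
* G. Grimmett, *The Random-Cluster Model* (2006), Thm. (3.1), Thm. (3.8), Lemma (4.13),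
  Lemma (4.14), proof of Thm. (4.58) — bib key `Grimmett2006`.
-/

noncomputable section

open MeasureTheory Finset SimpleGraph

namespace Literature.Probability.LatticeModels

variable {V : Type*} [Fintype V] [DecidableEq V] (G : SimpleGraph V) [DecidableRel G.Adj]

/-- **The law of the configuration inside a region is dominated by the wired measure of the
region** (Grimmett 2006, Lemma (4.14)(b) summed over the conditioning): for `U ⊆ E(G)`, a
wired set `W ⊇ B` containing both endpoints of every edge of `G` off `U`, `0 ≤ p ≤ 1`, `q ≥ 1`,
and every increasing event `A`, `φ^B_{G,p,q}({ω ∩ U ∈ A}) ≤ φ^W_{⟨U⟩,p,q}(A)`.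
[cite: Grimmett2006, Lemma (4.13) and Lemma (4.14)(b)] -/
theorem rcMeasure_real_inter_mem_le_fromEdgeSet {p q : ℝ} (hp : p ∈ Set.Icc (0 : ℝ) 1) (hq : 1 ≤ q)
    (B : Set V) (U : Finset (Sym2 V)) (hU : U ⊆ G.edgeFinset) {W : Set V} (hBW : B ⊆ W)
    (hW : ∀ e ∈ G.edgeFinset, e ∉ U → ∀ x ∈ e, x ∈ W)
    {A : Set (Percolation.BondConfig V)} (hA : IsUpperSet A) :
    (rcMeasure G p q B).real {ω | ω ∩ ↑U ∈ A} ≤ (rcMeasure (fromEdgeSet (U : Set (Sym2 V))) p q W).real A := by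
  classical
  have hq0 : 0 < q := one_pos.trans_le hq
  haveI : IsProbabilityMeasure (rcMeasure G p q B) := isProbabilityMeasure_rcMeasure G hp hq0 B
  set φ := rcMeasure G p q B with hφ
  set X : Set (Percolation.BondConfig V) := {ω | ω ∩ ↑U ∈ A} with hX
  set C : Finset (Sym2 V) → Set (Percolation.BondConfig V) := fun ζ => {ω | ω ∩ (↑U : Set (Sym2 V))ᶜ = ↑ζ} with hC
  -- decomposition of any event along the cylinders of `E ∖ U`
  have hdecomp : ∀ Y : Set (Percolation.BondConfig V), φ.real Y = ∑ ζ ∈ (G.edgeFinset \ U).powerset, φ.real (Y ∩ C ζ) := by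
    intro Y
    rw [rcMeasure_real_apply G hp hq0 B Y]
    have hfib := (Finset.sum_fiberwise_of_maps_to (s := G.edgeFinset.powerset) (t := (G.edgeFinset \ U).powerset)
      (g := fun ω : Finset (Sym2 V) => ω \ U)
      (fun ω hω => Finset.mem_powerset.2 (Finset.sdiff_subset_sdiff (Finset.mem_powerset.1 hω) subset_rfl))
      (f := fun ω => if (↑ω : Percolation.BondConfig V) ∈ Y then rcWeight G p q B ω / rcPartitionFunction G p q B else 0)).symm
    rw [hfib]
    refine Finset.sum_congr rfl fun ζ _ => ?_
    rw [rcMeasure_real_apply G hp hq0 B (Y ∩ C ζ), Finset.sum_filter]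
    refine Finset.sum_congr rfl fun ω _ => ?_
    have hiff : ω \ U = ζ ↔ (↑ω : Percolation.BondConfig V) ∈ C ζ := by
      simp only [hC, Set.mem_setOf_eq]
      rw [← Set.sdiff_eq, ← Finset.coe_sdiff, Finset.coe_inj]
    by_cases h1 : ω \ U = ζ
    · rw [if_pos h1]
      by_cases h2 : (↑ω : Percolation.BondConfig V) ∈ Y
      · rw [if_pos h2, if_pos ⟨h2, hiff.1 h1⟩]
      · rw [if_neg h2, if_neg (fun h => h2 h.1)]
    · rw [if_neg h1, if_neg (fun h => h1 (hiff.2 h.2))]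
  rw [hdecomp X]
  have hsum1 : ∑ ζ ∈ (G.edgeFinset \ U).powerset, φ.real (C ζ) = 1 := by
    have := hdecomp Set.univ
    simp only [Set.univ_inter] at this
    rw [← this, probReal_univ]
  calc ∑ ζ ∈ (G.edgeFinset \ U).powerset, φ.real (X ∩ C ζ)
      ≤ ∑ ζ ∈ (G.edgeFinset \ U).powerset, φ.real (C ζ) * (rcMeasure (fromEdgeSet (U : Set (Sym2 V))) p q W).real A := by
        refine Finset.sum_le_sum fun ζ hζ => ?_
        rw [Finset.mem_powerset] at hζ
        refine rcMeasure_real_inter_cylinder_le_mul_fromEdgeSet G hp hq B U hU (↑ζ) hBW ?_ hA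
        intro e he x hx
        have he' := hζ (Finset.mem_coe.1 he)
        rw [Finset.mem_sdiff] at he'
        exact hW e he'.1 he'.2 x hx
    _ = (rcMeasure (fromEdgeSet (U : Set (Sym2 V))) p q W).real A := by
        rw [← Finset.sum_mul, hsum1, one_mul]

end Literature.Probability.LatticeModels

namespace Literature.Probability.LatticeModels

open MeasureTheory Finset SimpleGraph

section GenericRC

variable {V : Type*} [Fintype V] [DecidableEq V] (G : SimpleGraph V) [DecidableRel G.Adj]

/-- **The cost of a wiring**: for `q ≥ 1` and a finite wired set `B`, every event satisfies
`φ^B_{G,p,q}(E) ≤ q^{|B|-1} φ^∅_{G,p,q}(E)` (`w^B ≤ w^∅` and `Z^∅ ≤ q^{|B|-1} Z^B`).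
[cite: Grimmett2006, proof of Thm. (4.58)] -/
theorem rcMeasure_real_wired_le_pow_mul_free {p q : ℝ} (hp : p ∈ Set.Icc (0 : ℝ) 1) (hq : 1 ≤ q)
    (B : Finset V) (E : Set (Percolation.BondConfig V)) :
    (rcMeasure G p q (↑B : Set V)).real E ≤ q ^ (#B - 1) * (rcMeasure G p q ∅).real E := by
  classical
  have hq0 : 0 < q := one_pos.trans_le hq
  have hZB := rcPartitionFunction_pos G hp hq0 (↑B : Set V)
  have hZ0 := rcPartitionFunction_pos G hp hq0 (∅ : Set V)
  have hZle := rcPartitionFunction_free_le_pow_mul_wired G hp hq B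
  rw [rcMeasure_real_apply G hp hq0 _ E, rcMeasure_real_apply G hp hq0 _ E, Finset.mul_sum]
  refine Finset.sum_le_sum fun ω _ => ?_
  split_ifs with h
  · rw [div_le_iff₀ hZB]
    calc rcWeight G p q (↑B) ω ≤ rcWeight G p q ∅ ω := rcWeight_wired_le_free G hp hq _ ω
      _ = rcWeight G p q ∅ ω / rcPartitionFunction G p q ∅ * rcPartitionFunction G p q ∅ := by field_simp
      _ ≤ rcWeight G p q ∅ ω / rcPartitionFunction G p q ∅ * (q ^ (#B - 1) * rcPartitionFunction G p q ↑B) := by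
          gcongr
          exact div_nonneg (rcWeight_nonneg G hp hq0.le _ _) hZ0.le
      _ = q ^ (#B - 1) * (rcWeight G p q ∅ ω / rcPartitionFunction G p q ∅) * rcPartitionFunction G p q ↑B := by ring
  · simp

/-- **Finite energy (insertion tolerance), unconditional form**: for an edge `e` of `G`, `0 ≤ p ≤ 1`,
`q ≥ 1`: `φ^B_{G,p,q}(e open) ≥ p/(p + q(1-p))` — pairing `ω ∌ e` with `ω ∪ {e}`, whose weight is
at least `p/((1-p) q)` times that of `ω` (opening an edge merges at most two clusters).
[cite: Grimmett2006, Thm. (3.1)(a), eq. (3.3)] -/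
theorem rcMeasure_real_edgeOpen_ge {p q : ℝ} (hp : p ∈ Set.Icc (0 : ℝ) 1) (hq : 1 ≤ q) (B : Set V)
    {e : Sym2 V} (he : e ∈ G.edgeFinset) :
    p / (p + q * (1 - p)) ≤ (rcMeasure G p q B).real {ω | e ∈ ω} := by
  classical
  induction e using Sym2.ind with | h u v => ?_
  set e : Sym2 V := s(u, v) with he_def
  have hq0 : 0 < q := one_pos.trans_le hq
  have hZ := rcPartitionFunction_pos G hp hq0 B
  have hp0 : 0 ≤ p := hp.1
  have hp1 : 0 ≤ 1 - p := sub_nonneg.2 hp.2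
  -- the two sums over configurations containing / avoiding `e`
  set S₁ := ∑ ω ∈ G.edgeFinset.powerset with e ∈ ω, rcWeight G p q B ω with hS₁
  set S₀ := ∑ ω ∈ G.edgeFinset.powerset with e ∉ ω, rcWeight G p q B ω with hS₀
  have hS₁0 : 0 ≤ S₁ := Finset.sum_nonneg fun ω _ => rcWeight_nonneg G hp hq0.le B ω
  have hS₀0 : 0 ≤ S₀ := Finset.sum_nonneg fun ω _ => rcWeight_nonneg G hp hq0.le B ω
  have hZsplit : rcPartitionFunction G p q B = S₁ + S₀ := by
    rw [rcPartitionFunction, hS₁, hS₀, ← Finset.sum_filter_add_sum_filter_not _ (fun ω => e ∈ ω)]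
  have hreal : (rcMeasure G p q B).real {ω | e ∈ ω} = S₁ / rcPartitionFunction G p q B := by
    rw [rcMeasure_real_apply G hp hq0 B, hS₁, Finset.sum_filter, Finset.sum_div]
    refine Finset.sum_congr rfl fun ω _ => ?_
    simp only [Set.mem_setOf_eq, Finset.mem_coe]
    split_ifs <;> simp
  -- key: `p · S₀ ≤ q (1 - p) · S₁`, by the injection `ω ↦ insert e ω`
  have hkey : p * S₀ ≤ q * (1 - p) * S₁ := by
    rw [hS₀, hS₁, Finset.mul_sum, Finset.mul_sum]
    -- reindex the right-hand side along `insert e`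
    have hinj : ∀ ω ∈ G.edgeFinset.powerset.filter (fun ω => e ∉ ω),
        insert e ω ∈ G.edgeFinset.powerset.filter (fun ω => e ∈ ω) := by
      intro ω hω
      rw [Finset.mem_filter, Finset.mem_powerset] at hω ⊢
      exact ⟨Finset.insert_subset he hω.1, Finset.mem_insert_self _ _⟩
    calc ∑ ω ∈ G.edgeFinset.powerset with e ∉ ω, p * rcWeight G p q B ω
        ≤ ∑ ω ∈ G.edgeFinset.powerset with e ∉ ω, q * (1 - p) * rcWeight G p q B (insert e ω) := by
          refine Finset.sum_le_sum fun ω hω => ?_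
          rw [Finset.mem_filter, Finset.mem_powerset] at hω
          -- compare the weights of `ω` and `insert e ω`
          unfold rcWeight
          have hcard : #(insert e ω) = #ω + 1 := Finset.card_insert_of_notMem hω.2
          have hcard' : #(G.edgeFinset \ ω) = #(G.edgeFinset \ insert e ω) + 1 := by
            have h1 : G.edgeFinset \ ω = insert e (G.edgeFinset \ insert e ω) := by
              ext f
              simp only [Finset.mem_sdiff, Finset.mem_insert]
              constructor
              · rintro ⟨hf, hfω⟩
                by_cases hfe : f = e
                · exact Or.inl hfe
                · exact Or.inr ⟨hf, fun h => h.elim hfe hfω⟩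
              · rintro (rfl | ⟨hf, hfn⟩)
                · exact ⟨he, hω.2⟩
                · exact ⟨hf, fun h => hfn (Or.inr h)⟩
            rw [h1, Finset.card_insert_of_notMem]
            simp
          have hk : clusterCount (↑ω : Percolation.BondConfig V) B ≤
              clusterCount (↑(insert e ω) : Percolation.BondConfig V) B + 1 := by
            have := clusterCount_insert ω u v B
            rw [← he_def] at this
            split_ifs at this <;> omega
          have hqpow : q ^ clusterCount (↑ω : Percolation.BondConfig V) B ≤
              q * q ^ clusterCount (↑(insert e ω) : Percolation.BondConfig V) B := by
            rw [← pow_succ']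
            exact pow_le_pow_right₀ hq hk
          rw [hcard, hcard']
          have h0 : 0 ≤ p ^ (#ω + 1) * (1 - p) ^ #(G.edgeFinset \ insert e ω) := by positivity
          calc p * (p ^ #ω * (1 - p) ^ (#(G.edgeFinset \ insert e ω) + 1) * q ^ clusterCount (↑ω : Percolation.BondConfig V) B)
              = (1 - p) * (p ^ (#ω + 1) * (1 - p) ^ #(G.edgeFinset \ insert e ω)) *
                  q ^ clusterCount (↑ω : Percolation.BondConfig V) B := by ring
            _ ≤ (1 - p) * (p ^ (#ω + 1) * (1 - p) ^ #(G.edgeFinset \ insert e ω)) *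
                  (q * q ^ clusterCount (↑(insert e ω) : Percolation.BondConfig V) B) :=
                mul_le_mul_of_nonneg_left hqpow (mul_nonneg hp1 h0)
            _ = q * (1 - p) * (p ^ (#ω + 1) * (1 - p) ^ #(G.edgeFinset \ insert e ω) *
                  q ^ clusterCount (↑(insert e ω) : Percolation.BondConfig V) B) := by ring
      _ = ∑ ω' ∈ (G.edgeFinset.powerset.filter (fun ω => e ∉ ω)).image (fun ω : Finset (Sym2 V) => insert e ω),
            q * (1 - p) * rcWeight G p q B ω' := by
          have hinj' : Set.InjOn (fun ω : Finset (Sym2 V) => insert e ω)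
              ↑(G.edgeFinset.powerset.filter (fun ω => e ∉ ω)) := by
            intro ω₁ hω₁ ω₂ hω₂ h
            rw [Finset.mem_coe, Finset.mem_filter] at hω₁ hω₂
            have h' : (insert e ω₁ : Finset (Sym2 V)).erase e = (insert e ω₂ : Finset (Sym2 V)).erase e := by
              simp only at h; rw [h]
            rwa [Finset.erase_insert hω₁.2, Finset.erase_insert hω₂.2] at h'
          exact (Finset.sum_image (f := fun ω' => q * (1 - p) * rcWeight G p q B ω') hinj').symm
      _ ≤ ∑ ω ∈ G.edgeFinset.powerset with e ∈ ω, q * (1 - p) * rcWeight G p q B ω := by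
          refine Finset.sum_le_sum_of_subset_of_nonneg ?_ ?_
          · intro ω' hω'
            rw [Finset.mem_image] at hω'
            obtain ⟨ω, hω, rfl⟩ := hω'
            exact hinj ω hω
          · intro ω _ _
            exact mul_nonneg (mul_nonneg hq0.le hp1) (rcWeight_nonneg G hp hq0.le B ω)
  rw [hreal, hZsplit]
  -- `p/(p + q(1-p)) ≤ S₁/(S₁ + S₀)`
  rcases (add_nonneg hS₁0 hS₀0).eq_or_lt with h0 | hpos
  · exfalso; rw [hZsplit] at hZ; linarith
  have hden : 0 < p + q * (1 - p) := by
    rcases hp.1.eq_or_lt with h | h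
    · rw [← h]; simp; exact hq0
    · positivity
  rw [div_le_div_iff₀ hden hpos]
  nlinarith [hkey, hS₁0]

/-- **FKG along a path**: for increasing `A` and an edge `e` of `G`,
`φ(A ∩ {e open}) ≥ (p/(p + q(1-p))) φ(A)`. [cite: Grimmett2006, Thm. (3.8) and Thm. (3.1)(a)] -/
theorem rcMeasure_real_inter_edgeOpen_ge {p q : ℝ} (hp : p ∈ Set.Icc (0 : ℝ) 1) (hq : 1 ≤ q) (B : Set V)
    {A : Set (Percolation.BondConfig V)} (hA : IsUpperSet A) {e : Sym2 V} (he : e ∈ G.edgeFinset) :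
    p / (p + q * (1 - p)) * (rcMeasure G p q B).real A ≤ (rcMeasure G p q B).real (A ∩ {ω | e ∈ ω}) := by
  have hfkg := rcMeasure_fkg_holds G hp hq B hA (A' := {ω | e ∈ ω}) (fun _ _ h h1 => h h1)
  have h1 := rcMeasure_real_edgeOpen_ge G hp hq B he
  calc p / (p + q * (1 - p)) * (rcMeasure G p q B).real A
      ≤ (rcMeasure G p q B).real {ω | e ∈ ω} * (rcMeasure G p q B).real A :=
        mul_le_mul_of_nonneg_right h1 measureReal_nonneg
    _ = (rcMeasure G p q B).real A * (rcMeasure G p q B).real {ω | e ∈ ω} := mul_comm _ _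
    _ ≤ _ := hfkg

/-- **Extending an open connection along a path of the graph** costs at most a factor
`(p/(p + q(1-p)))^{length}`: for a walk `w` of `G` from `y` to `z`,
`φ(x ↔ z) ≥ (p/(p+q(1-p)))^{|w|} φ(x ↔ y)` (connections by open edges, `fromEdgeSet`).
[cite: Grimmett2006, Thm. (3.8) and Thm. (3.1)(a)] -/
theorem rcMeasure_real_reachable_ge_of_walk {p q : ℝ} (hp : p ∈ Set.Icc (0 : ℝ) 1) (hq : 1 ≤ q) (B : Set V)
    (x : V) {y z : V} (w : G.Walk y z) :
    (p / (p + q * (1 - p))) ^ w.length * (rcMeasure G p q B).real {ω | (fromEdgeSet ω).Reachable x y} ≤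
      (rcMeasure G p q B).real {ω | (fromEdgeSet ω).Reachable x z} := by
  classical
  have hq0 : 0 < q := one_pos.trans_le hq
  haveI : IsProbabilityMeasure (rcMeasure G p q B) := isProbabilityMeasure_rcMeasure G hp hq0 B
  induction w with
  | nil => simp
  | @cons a b _ hadj w' ih =>
    -- `{x ↔ a} ∩ {s(a,b) open} ⊆ {x ↔ b}`, then the induction hypothesis from `b`
    have hup : IsUpperSet {ω : Percolation.BondConfig V | (fromEdgeSet ω).Reachable x a} :=
      fun _ _ h h1 => h1.mono (fromEdgeSet_mono h)
    have he : s(a, b) ∈ G.edgeFinset := SimpleGraph.mem_edgeFinset.2 hadj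
    have h1 := rcMeasure_real_inter_edgeOpen_ge G hp hq B hup he
    have hsub : {ω : Percolation.BondConfig V | (fromEdgeSet ω).Reachable x a} ∩ {ω | s(a, b) ∈ ω} ⊆
        {ω | (fromEdgeSet ω).Reachable x b} := by
      rintro ω ⟨hxa, hab⟩
      exact hxa.trans (SimpleGraph.Adj.reachable ((SimpleGraph.fromEdgeSet_adj _).2 ⟨hab, hadj.ne⟩))
    have h2 := measureReal_mono hsub (measure_ne_top (rcMeasure G p q B) _)
    have hr0 : 0 ≤ p / (p + q * (1 - p)) := by
      apply div_nonneg hp.1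
      nlinarith [hp.1, hp.2, hq0]
    rw [SimpleGraph.Walk.length_cons, pow_succ]
    calc (p / (p + q * (1 - p))) ^ w'.length * (p / (p + q * (1 - p))) *
          (rcMeasure G p q B).real {ω | (fromEdgeSet ω).Reachable x a}
        = (p / (p + q * (1 - p))) ^ w'.length * ((p / (p + q * (1 - p))) *
          (rcMeasure G p q B).real {ω | (fromEdgeSet ω).Reachable x a}) := by ring
      _ ≤ (p / (p + q * (1 - p))) ^ w'.length * (rcMeasure G p q B).real {ω | (fromEdgeSet ω).Reachable x b} :=
          mul_le_mul_of_nonneg_left (h1.trans h2) (pow_nonneg hr0 _)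
      _ ≤ _ := ih

/-- In particular `φ(x ↔ z) ≥ (p/(p+q(1-p)))^{|w|}` for a walk `w` of `G` from `x` to `z`.
[cite: Grimmett2006, Thm. (3.8) and Thm. (3.1)(a)] -/
theorem rcMeasure_real_reachable_ge_pow {p q : ℝ} (hp : p ∈ Set.Icc (0 : ℝ) 1) (hq : 1 ≤ q) (B : Set V)
    {x z : V} (w : G.Walk x z) :
    (p / (p + q * (1 - p))) ^ w.length ≤ (rcMeasure G p q B).real {ω | (fromEdgeSet ω).Reachable x z} := by
  have hq0 : 0 < q := one_pos.trans_le hq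
  haveI : IsProbabilityMeasure (rcMeasure G p q B) := isProbabilityMeasure_rcMeasure G hp hq0 B
  have h := rcMeasure_real_reachable_ge_of_walk G hp hq B x w
  have h1 : (rcMeasure G p q B).real {ω | (fromEdgeSet ω).Reachable x x} = 1 := by
    rw [show {ω : Percolation.BondConfig V | (fromEdgeSet ω).Reachable x x} = Set.univ from
      Set.eq_univ_of_forall fun _ => SimpleGraph.Reachable.refl _, probReal_univ]
  rwa [h1, mul_one] at h

end GenericRC

end Literature.Probability.LatticeModels

namespace Literature.Probability.LatticeModels

open MeasureTheory Finset SimpleGraph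

/-! ### Adjacency in the interface graph -/

namespace DiscreteDobrushin

/-- Adjacency in the interface graph: adjacent in `Ω_δ` and neither endpoint on the free arc.
[cite: Smirnov2010, §2.1] -/
theorem interfaceGraph_adj_iff (D : DiscreteDobrushin) (v w : meshDomain D.Ω D.δ) :
    D.interfaceGraph.Adj v w ↔
      (discreteDomainGraph D.Ω D.δ).Adj v.1 w.1 ∧ v.1 ∉ D.zdArcB ∧ w.1 ∉ D.zdArcB := by
  classical
  simp only [interfaceGraph, domainSubgraph, SimpleGraph.deleteEdges_adj, SimpleGraph.comap_adj, Set.mem_setOf_eq,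
    Sym2.mem_iff, not_exists, not_and]
  constructor
  · rintro ⟨h, h'⟩
    exact ⟨h, fun hv => h' v (Or.inl rfl) hv, fun hw => h' w (Or.inr rfl) hw⟩
  · rintro ⟨h, hv, hw⟩
    refine ⟨h, ?_⟩
    rintro x (rfl | rfl)
    · exact hv
    · exact hw

end DiscreteDobrushin

namespace LatticeDobrushin

variable {W N : ℕ} {c : ℤ}

/-- The sites of the rectangle `R = [0, W] × [0, N]`. [folklore] -/
def IsReg (W N : ℕ) (x : Site 2) : Prop := 0 ≤ x 0 ∧ x 0 ≤ (W : ℤ) ∧ 0 ≤ x 1 ∧ x 1 ≤ (N : ℤ)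

/-- Membership in the rectangle is decidable. [folklore] -/
instance (W N : ℕ) : DecidablePred (IsReg W N) := fun x => by unfold IsReg; infer_instance

/-- **Where an open path can leave the rectangle**: an edge of the interface graph of the bar
domain from a site of `R` to a site off `R` goes from `(c+j, N)` up into the bar. [folklore] -/
theorem exit_edge_barDomain (hc : 0 ≤ c) (hcW : c + 3 ≤ W) {v w : Site 2} (hv : IsReg W N v)
    (hwS : w ∈ (barDomain W N c).S) (hw : ¬ IsReg W N w) (hwB : w ∉ (barDomain W N c).toDobrushin.zdArcB)
    (hadj : (zdGraph 2).Adj v w) : v 1 = N ∧ c ≤ v 0 ∧ v 0 ≤ c + 3 := by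
  rw [zdArcB_barDomain hc hcW] at hwB
  simp only [Set.mem_setOf_eq, not_and] at hwB
  rw [mem_barDomain_S] at hwS
  unfold IsReg at hv hw
  have hring : w 0 = -1 ∨ w 0 = (W : ℤ) + 1 ∨ w 1 = -1 ∨ w 1 = (N : ℤ) + 1 := by omega
  have hbar := hwB (mem_barDomain_S.2 hwS) hring
  obtain ⟨i, hi | hi⟩ := (zdGraph_adj_iff v w).1 hadj
  · have h0 := congrFun hi 0; have h1 := congrFun hi 1
    fin_cases i <;> simp at h0 h1 <;> omega
  · have h0 := congrFun hi 0; have h1 := congrFun hi 1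
    fin_cases i <;> simp at h0 h1 <;> omega

section Exit

/-- The discrete Dobrushin datum of the bar domain (abbreviation). [folklore] -/
abbrev barD (W N : ℕ) (c : ℤ) : DiscreteDobrushin := (barDomain W N c).toDobrushin

/-- The vertex type of the interface graph of the bar domain (abbreviation). [folklore] -/
abbrev BarV (W N : ℕ) (c : ℤ) : Type := ↥(meshDomain (barD W N c).Ω (barD W N c).δ)

open scoped Classical in
/-- The edges of the interface graph of the bar domain with both endpoints in `R`. [folklore] -/
def regEdges (W N : ℕ) (c : ℤ) : Finset (Sym2 (BarV W N c)) :=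
  (barD W N c).interfaceGraph.edgeFinset.filter fun e => ∀ x ∈ e, IsReg W N x.1

/-- The top-row site `(c + j, N)` under the bar, as a vertex of `Ω_δ`. [folklore] -/
def topSite (W N : ℕ) (c : ℤ) (hc : 0 ≤ c) (hcW : c + 3 ≤ W) (j : Fin 4) : BarV W N c :=
  ⟨![c + j, N], by
    rw [(barDomain W N c).meshDomain_eq, mem_barDomain_S]
    have : (j : ℤ) ≤ 3 := by have := j.isLt; omega
    simp; omega⟩

/-- **Exit decomposition.** If `x ∈ R` is joined to the bar by `ω`-open edges of the interface
graph, then `x` is joined inside `R` (by `ω`-open edges with both endpoints in `R`) to one of the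
four sites `(c+j, N)` under the bar. [cite: DuminilCopinHonglerNolin2011, §4, proof of Proposition 13] -/
theorem exists_reachable_topSite_of_openJoined (hc : 0 ≤ c) (hcW : c + 3 ≤ W) {x : BarV W N c} (hx : IsReg W N x.1)
    {η : Percolation.BondConfig (BarV W N c)} (h : (barD W N c).OpenJoinedToArcA x (DiscreteDobrushin.liftSet (barD W N c) η)) :
    ∃ j : Fin 4, (fromEdgeSet (η ∩ ↑(regEdges W N c))).Reachable x (topSite W N c hc hcW j) := by
  classical
  obtain ⟨b, hb, hreach⟩ := h
  -- the open graph
  set K : SimpleGraph (BarV W N c) := fromEdgeSet {e' | e' ∈ (barD W N c).interfaceGraph.edgeSet ∧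
    Sym2.map Subtype.val e' ∈ DiscreteDobrushin.liftSet (barD W N c) η} with hK
  have hbreg : ¬ IsReg W N b.1 := by
    have hb : b.1 ∈ (barD W N c).zdArcA := hb
    rw [zdArcA_barDomain hc hcW, mem_barDomain_A] at hb
    unfold IsReg; omega
  obtain ⟨p⟩ := hreach
  -- induction on the walk, for regular start points and non-regular end points
  suffices key : ∀ (v b' : BarV W N c) (p : K.Walk v b'), ¬ IsReg W N b'.1 → IsReg W N v.1 →
      ∃ j : Fin 4, (fromEdgeSet (η ∩ ↑(regEdges W N c))).Reachable v (topSite W N c hc hcW j) from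
    key x b p hbreg hx
  intro v b' p
  induction p with
  | nil => intro hb' hv; exact absurd hv hb'
  | @cons v v' _ hadj p' ih =>
    intro hb' hv
    rw [hK, SimpleGraph.fromEdgeSet_adj, Set.mem_setOf_eq, DiscreteDobrushin.map_mem_liftSet_iff] at hadj
    obtain ⟨⟨he, hη⟩, hne⟩ := hadj
    have hadjG : (barD W N c).interfaceGraph.Adj v v' := (SimpleGraph.mem_edgeSet _).1 he
    by_cases hv' : IsReg W N v'.1
    · obtain ⟨j, hj⟩ := ih hb' hv'
      refine ⟨j, SimpleGraph.Reachable.trans (SimpleGraph.Adj.reachable ?_) hj⟩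
      rw [SimpleGraph.fromEdgeSet_adj]
      refine ⟨⟨hη, ?_⟩, hne⟩
      rw [Finset.mem_coe, regEdges, Finset.mem_filter]
      refine ⟨SimpleGraph.mem_edgeFinset.2 he, ?_⟩
      intro y hy
      rw [Sym2.mem_iff] at hy
      rcases hy with rfl | rfl
      · exact hv
      · exact hv'
    · -- the edge leaves `R`: `v = (c + j, N)`
      rw [DiscreteDobrushin.interfaceGraph_adj_iff] at hadjG
      obtain ⟨hadj', -, hB'⟩ := hadjG
      rw [(barDomain W N c).adj_iff] at hadj'
      obtain ⟨hzd, -, hw'S⟩ := hadj'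
      obtain ⟨h1, h2, h3⟩ := exit_edge_barDomain hc hcW hv hw'S hv' hB' hzd
      refine ⟨⟨(v.1 0 - c).toNat, by omega⟩, ?_⟩
      have : topSite W N c hc hcW ⟨(v.1 0 - c).toNat, by omega⟩ = v := by
        apply Subtype.ext
        simp only [topSite]
        have := Int.toNat_of_nonneg (show 0 ≤ v.1 0 - c by omega)
        funext i; fin_cases i
        · simp; omega
        · simp; omega
      rw [this]

/-- The vertices wired in the comparison: everything off `R`, and the four sites under the bar. [folklore] -/
def barWiredSet (W N : ℕ) (c : ℤ) : Set (BarV W N c) :=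
  {v | ¬ IsReg W N v.1 ∨ (v.1 1 = N ∧ c ≤ v.1 0 ∧ v.1 0 ≤ c + 3)}

open scoped Classical in
/-- Every edge of the interface graph not inside `R` has both endpoints in the wired set. [folklore] -/
theorem mem_barWiredSet_of_not_mem_regEdges (hc : 0 ≤ c) (hcW : c + 3 ≤ W) {e : Sym2 (BarV W N c)}
    (he : e ∈ (barD W N c).interfaceGraph.edgeFinset)
    (heU : e ∉ regEdges W N c) : ∀ x ∈ e, x ∈ barWiredSet W N c := by
  rw [regEdges, Finset.mem_filter, not_and] at heU
  have hnot := heU he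
  push Not at hnot
  obtain ⟨w, hw, hwreg⟩ := hnot
  intro y hy
  by_cases hyreg : IsReg W N y.1
  · -- `y` regular, `w` not: the edge `{y, w}` leaves `R`
    right
    have hyw : y ≠ w := fun h => hwreg (h ▸ hyreg)
    have he' : e = s(y, w) := (Sym2.mem_and_mem_iff hyw).1 ⟨hy, hw⟩
    rw [he'] at he
    have hadjG : (barD W N c).interfaceGraph.Adj y w := (SimpleGraph.mem_edgeSet _).1 (SimpleGraph.mem_edgeFinset.1 he)
    rw [DiscreteDobrushin.interfaceGraph_adj_iff] at hadjG
    obtain ⟨hadj', -, hB'⟩ := hadjG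
    rw [(barDomain W N c).adj_iff] at hadj'
    exact exit_edge_barDomain hc hcW hyreg hadj'.2.2 hwreg hB' hadj'.1
  · exact Or.inl hyreg

/-- The wired arc (the bar) lies in the wired set. [folklore] -/
theorem preimage_zdArcA_subset_barWiredSet (hc : 0 ≤ c) (hcW : c + 3 ≤ W) :
    (Subtype.val ⁻¹' (barD W N c).zdArcA : Set (BarV W N c)) ⊆ barWiredSet W N c := by
  intro v hv
  have hv : v.1 ∈ (barD W N c).zdArcA := hv
  rw [zdArcA_barDomain hc hcW, mem_barDomain_A] at hv
  left; unfold IsReg; omega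

open scoped Classical in
/-- **The connection probability in the bar domain is controlled by connections inside `R`.**
For `x ∈ R`, with `U` the edges of `R`, `W'` the wired set above and `φ_U := φ^{W'}_{⟨U⟩, p_c, 2}`:
`P_bar(x ↔ bar) ≤ ∑_{j<4} φ_U(x ↔ (c+j, N))`. (Exit decomposition, then the domination of the
configuration inside `U` by the wired measure of `U`.) [cite: DuminilCopinHonglerNolin2011, §4, proof of Proposition 13] -/
theorem rcMeasure_openJoined_le_sum (hc : 0 ≤ c) (hcW : c + 3 ≤ W) (x : BarV W N c) (hx : IsReg W N x.1) :
    (rcMeasure (barD W N c).interfaceGraph criticalFKIsingParam 2 (Subtype.val ⁻¹' (barD W N c).zdArcA)).real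
        {η | (barD W N c).OpenJoinedToArcA x (DiscreteDobrushin.liftSet (barD W N c) η)} ≤
      ∑ j : Fin 4, (rcMeasure (fromEdgeSet (↑(regEdges W N c) : Set (Sym2 (BarV W N c)))) criticalFKIsingParam 2
        (barWiredSet W N c)).real {θ | (fromEdgeSet θ).Reachable x (topSite W N c hc hcW j)} := by
  classical
  set φ := rcMeasure (barD W N c).interfaceGraph criticalFKIsingParam 2 (Subtype.val ⁻¹' (barD W N c).zdArcA)
  have hq : (1 : ℝ) ≤ 2 := by norm_num
  haveI : IsProbabilityMeasure φ := isProbabilityMeasure_rcMeasure _ criticalFKIsingParam_mem_Icc two_pos _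
  -- union bound over the exit site
  have hsub : {η | (barD W N c).OpenJoinedToArcA x (DiscreteDobrushin.liftSet (barD W N c) η)} ⊆
      ⋃ j ∈ (Finset.univ : Finset (Fin 4)), {η : Percolation.BondConfig (BarV W N c) |
        η ∩ ↑(regEdges W N c) ∈ {θ : Percolation.BondConfig (BarV W N c) | (fromEdgeSet θ).Reachable x (topSite W N c hc hcW j)}} := by
    intro η hη
    obtain ⟨j, hj⟩ := exists_reachable_topSite_of_openJoined hc hcW hx hη
    exact Set.mem_biUnion (Finset.mem_univ j) hj
  refine (measureReal_mono hsub (measure_ne_top φ _)).trans ((measureReal_biUnion_finset_le _ _).trans ?_)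
  refine Finset.sum_le_sum fun j _ => ?_
  have hU : regEdges W N c ⊆ (barD W N c).interfaceGraph.edgeFinset := fun e he => by
    rw [regEdges, Finset.mem_filter] at he; exact he.1
  refine rcMeasure_real_inter_mem_le_fromEdgeSet _ criticalFKIsingParam_mem_Icc hq _ (regEdges W N c)
    hU (preimage_zdArcA_subset_barWiredSet hc hcW)
    (fun e he heU => mem_barWiredSet_of_not_mem_regEdges hc hcW he heU) ?_
  -- the event is increasing
  intro θ₁ θ₂ hle h1
  exact h1.mono (SimpleGraph.fromEdgeSet_mono hle)

end Exit

end LatticeDobrushin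

end Literature.Probability.LatticeModels

namespace Literature.Probability.LatticeModels

open MeasureTheory Finset SimpleGraph

namespace LatticeDobrushin

variable {W N : ℕ} {c : ℤ}

/-! ### The Dobrushin measure of the bar domain as a random-cluster measure -/

/-- The connection event under the FK Dobrushin measure of the bar domain is the corresponding
event under the random-cluster measure of its interface graph (wired on the bar).
[cite: Smirnov2010, §2.1–2.2] -/
theorem fkDobrushin_real_openJoined_eq (hc : 0 ≤ c) (hcW : c + 3 ≤ W) (x : BarV W N c) :
    (fkDobrushinMeasure (barD W N c)).real {ω | (barD W N c).OpenJoinedToArcA x ω} =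
      (open scoped Classical in
        rcMeasure (barD W N c).interfaceGraph criticalFKIsingParam 2 (Subtype.val ⁻¹' (barD W N c).zdArcA)).real
        {η | (barD W N c).OpenJoinedToArcA x (DiscreteDobrushin.liftSet (barD W N c) η)} := by
  classical
  have hE := isZdAdmissible_barDomain (N := N) hc hcW
  rw [fkDobrushinMeasure_of_pos _ hE.isBounded hE.delta_pos]
  have hinst : (_root_.Literature.Probability.LatticeModels.meshDomain_finite hE.isBounded hE.delta_pos).fintype =
      (inferInstance : Fintype (BarV W N c)) :=
    Subsingleton.elim _ _
  rw [hinst, DiscreteDobrushin.fkInterfaceMeasure_eq_map, measureReal_def, measureReal_def,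
    (DiscreteDobrushin.measurableEmbedding_liftSet (D := barD W N c)).map_apply]
  rfl

/-! ### The rectangle inside the bar domain -/

/-- The vertex type of the lattice rectangle `[0, W] × [0, N]`. [folklore] -/
abbrev RectV (W N : ℕ) : Type := ↥((Percolation.rectangle W N : Finset (Site 2)) : Set (Site 2))

/-- A site of the rectangle is a regular site of the bar domain. [folklore] -/
theorem isReg_of_mem_rectangle {v : Site 2} (hv : v ∈ Percolation.rectangle W N) : IsReg W N v := by
  rw [Percolation.mem_rectangle_iff] at hv
  exact hv

/-- The inclusion of the rectangle into the vertex set of the bar domain. [folklore] -/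
def rectEmb (W N : ℕ) (c : ℤ) : RectV W N ↪ BarV W N c where
  toFun v := ⟨v.1, by
    rw [(barDomain W N c).meshDomain_eq, mem_barDomain_S]
    have := isReg_of_mem_rectangle (Finset.mem_coe.1 v.2)
    unfold IsReg at this; omega⟩
  inj' v w h := Subtype.ext (congrArg (fun u : BarV W N c => u.1) h)

/-- The inclusion is the identity on the underlying sites. [folklore] -/
@[simp] theorem rectEmb_apply_val (v : RectV W N) : (rectEmb W N c v).1 = v.1 := rfl

/-- The image of the rectangle consists of the regular vertices. [folklore] -/
theorem isReg_rectEmb (v : RectV W N) : IsReg W N (rectEmb W N c v).1 :=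
  isReg_of_mem_rectangle (Finset.mem_coe.1 v.2)

/-- A regular vertex is in the image of the rectangle. [folklore] -/
theorem exists_rectEmb_of_isReg {u : BarV W N c} (hu : IsReg W N u.1) : ∃ v : RectV W N, rectEmb W N c v = u :=
  ⟨⟨u.1, Finset.mem_coe.2 (Percolation.mem_rectangle_iff.2 hu)⟩, Subtype.ext rfl⟩

/-- **The edges inside `R` of the interface graph are exactly the images of the edges of the
lattice rectangle.** [folklore] -/
theorem edgeFinset_fromEdgeSet_regEdges (hc : 0 ≤ c) (hcW : c + 3 ≤ W)
    {instF : Fintype (fromEdgeSet (↑(regEdges W N c) : Set (Sym2 (BarV W N c)))).edgeSet}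
    {instR : Fintype ((zdGraph 2).induce ((Percolation.rectangle W N : Finset (Site 2)) : Set (Site 2))).edgeSet} :
    @SimpleGraph.edgeFinset _ (fromEdgeSet (↑(regEdges W N c) : Set (Sym2 (BarV W N c)))) instF =
      (@SimpleGraph.edgeFinset _ ((zdGraph 2).induce ((Percolation.rectangle W N : Finset (Site 2)) : Set (Site 2))) instR).map
        (rectEmb W N c).sym2Map := by
  classical
  ext e'
  rw [SimpleGraph.mem_edgeFinset, SimpleGraph.edgeSet_fromEdgeSet, Set.mem_sdiff, Finset.mem_coe, Finset.mem_map]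
  constructor
  · rintro ⟨he', hdiag⟩
    rw [regEdges, Finset.mem_filter] at he'
    obtain ⟨he'E, hreg⟩ := he'
    induction e' using Sym2.ind with | h a b => ?_
    have hadj : (barD W N c).interfaceGraph.Adj a b := (SimpleGraph.mem_edgeSet _).1 (SimpleGraph.mem_edgeFinset.1 he'E)
    rw [DiscreteDobrushin.interfaceGraph_adj_iff, (barDomain W N c).adj_iff] at hadj
    obtain ⟨va, hva⟩ := exists_rectEmb_of_isReg (hreg a (Sym2.mem_mk_left _ _))
    obtain ⟨vb, hvb⟩ := exists_rectEmb_of_isReg (hreg b (Sym2.mem_mk_right _ _))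
    refine ⟨s(va, vb), ?_, ?_⟩
    · rw [SimpleGraph.mem_edgeFinset, SimpleGraph.mem_edgeSet, SimpleGraph.comap_adj, Function.Embedding.coe_subtype]
      have h1 : va.1 = a.1 := by rw [← hva]; rfl
      have h2 : vb.1 = b.1 := by rw [← hvb]; rfl
      rw [h1, h2]; exact hadj.1.1
    · simp [hva, hvb]
  · rintro ⟨e, he, rfl⟩
    induction e using Sym2.ind with | h va vb => ?_
    rw [SimpleGraph.mem_edgeFinset, SimpleGraph.mem_edgeSet, SimpleGraph.comap_adj, Function.Embedding.coe_subtype] at he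
    have hne : rectEmb W N c va ≠ rectEmb W N c vb := by
      intro h; exact he.ne (congrArg Subtype.val ((rectEmb W N c).injective h))
    refine ⟨?_, ?_⟩
    · simp only [Function.Embedding.sym2Map_apply, Sym2.map_mk]
      rw [regEdges, Finset.mem_filter]
      refine ⟨SimpleGraph.mem_edgeFinset.2 ((SimpleGraph.mem_edgeSet _).2 ?_), ?_⟩
      · rw [DiscreteDobrushin.interfaceGraph_adj_iff, (barDomain W N c).adj_iff]
        have ha := isReg_rectEmb (c := c) va
        have hb := isReg_rectEmb (c := c) vb
        have haS : (rectEmb W N c va).1 ∈ (barDomain W N c).S := by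
          rw [mem_barDomain_S]; unfold IsReg at ha; simp only [rectEmb_apply_val] at ha ⊢; omega
        have hbS : (rectEmb W N c vb).1 ∈ (barDomain W N c).S := by
          rw [mem_barDomain_S]; unfold IsReg at hb; simp only [rectEmb_apply_val] at hb ⊢; omega
        refine ⟨⟨he, haS, hbS⟩, ?_, ?_⟩
        · rw [zdArcB_barDomain hc hcW]; rintro ⟨-, hring, -⟩
          unfold IsReg at ha; simp only [rectEmb_apply_val] at ha hring; omega
        · rw [zdArcB_barDomain hc hcW]; rintro ⟨-, hring, -⟩
          unfold IsReg at hb; simp only [rectEmb_apply_val] at hb hring; omega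
      · intro y hy
        simp only [Sym2.mem_iff] at hy
        rcases hy with rfl | rfl
        · exact isReg_rectEmb va
        · exact isReg_rectEmb vb
    · simp only [Function.Embedding.sym2Map_apply, Sym2.map_mk]
      exact hne

/-- The wired set of the comparison, read on the rectangle: the four sites under the bar. [folklore] -/
def rectTop (W N : ℕ) (c : ℤ) : Finset (RectV W N) :=
  Finset.univ.filter fun v => v.1 1 = N ∧ c ≤ v.1 0 ∧ v.1 0 ≤ c + 3

/-- `barWiredSet` is `rectTop` together with the idle vertices off the rectangle. [folklore] -/
theorem mem_barWiredSet_iff_rectTop (u : BarV W N c) :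
    u ∈ barWiredSet W N c ↔ ∀ v : RectV W N, rectEmb W N c v = u → v ∈ (↑(rectTop W N c) : Set (RectV W N)) := by
  constructor
  · rintro (hu | hu) v rfl
    · exact absurd (isReg_rectEmb v) hu
    · rw [Finset.mem_coe, rectTop, Finset.mem_filter]
      exact ⟨Finset.mem_univ _, hu⟩
  · intro h
    by_cases hu : IsReg W N u.1
    · obtain ⟨v, rfl⟩ := exists_rectEmb_of_isReg hu
      have := h v rfl
      rw [Finset.mem_coe, rectTop, Finset.mem_filter] at this
      exact Or.inr this.2
    · exact Or.inl hu

/-- The four sites under the bar: `rectTop` has exactly `4` elements when `0 ≤ c`, `c + 3 ≤ W`. [folklore] -/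
theorem card_rectTop (hc : 0 ≤ c) (hcW : c + 3 ≤ W) : #(rectTop W N c) = 4 := by
  -- an explicit bijection with `Fin 4`
  have key : rectTop W N c = (Finset.univ : Finset (Fin 4)).map
      ⟨fun j : Fin 4 => (⟨![c + j, N], Finset.mem_coe.2 (Percolation.mem_rectangle_iff.2 (by
          have : (j : ℤ) ≤ 3 := by have := j.isLt; omega
          simp; omega))⟩ : RectV W N),
        fun j j' h => by
          have := congrArg (fun v : RectV W N => v.1 0) h
          simp at this
          exact Fin.ext (by omega)⟩ := by
    ext v
    rw [rectTop, Finset.mem_filter, Finset.mem_map]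
    constructor
    · rintro ⟨-, h1, h2, h3⟩
      refine ⟨⟨(v.1 0 - c).toNat, by omega⟩, Finset.mem_univ _, ?_⟩
      apply Subtype.ext
      have := Int.toNat_of_nonneg (show 0 ≤ v.1 0 - c by omega)
      funext i; fin_cases i
      · simp; omega
      · simp; omega
    · rintro ⟨j, -, rfl⟩
      have : (j : ℤ) ≤ 3 := by have := j.isLt; omega
      refine ⟨Finset.mem_univ _, ?_⟩
      simp; omega
  rw [key, Finset.card_map, Finset.card_univ, Fintype.card_fin]

open scoped Classical in
/-- **The wired measure of the region `U` is the wired rectangle measure**: for `x₀, u₀` in the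
rectangle, `φ^{barWiredSet}_{⟨U⟩}(x₀ ↔ u₀) = φ^{rectTop}_{R}(x₀ ↔ u₀)` (idle vertices wired,
`rcMeasure_real_map_of_wired`). [cite: Grimmett2006, Lemma (4.13)] -/
theorem rcMeasure_regEdges_reachable_eq (hc : 0 ≤ c) (hcW : c + 3 ≤ W) (x₀ u₀ : RectV W N) :
    (rcMeasure (fromEdgeSet (↑(regEdges W N c) : Set (Sym2 (BarV W N c)))) criticalFKIsingParam 2
        (barWiredSet W N c)).real {θ | (fromEdgeSet θ).Reachable (rectEmb W N c x₀) (rectEmb W N c u₀)} =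
      (rcMeasure ((zdGraph 2).induce ((Percolation.rectangle W N : Finset (Site 2)) : Set (Site 2))) criticalFKIsingParam 2
        (↑(rectTop W N c) : Set (RectV W N))).real {θ | (fromEdgeSet θ).Reachable x₀ u₀} := by
  have hWne : (↑(rectTop W N c) : Set (RectV W N)).Nonempty := by
    rw [Finset.coe_nonempty, ← Finset.card_pos, card_rectTop hc hcW]; norm_num
  have hE : @SimpleGraph.edgeFinset (BarV W N c) (fromEdgeSet (↑(regEdges W N c) : Set (Sym2 (BarV W N c))))
      (SimpleGraph.fintypeEdgeSet _) =
      ((zdGraph 2).induce ((Percolation.rectangle W N : Finset (Site 2)) : Set (Site 2))).edgeFinset.map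
        (rectEmb W N c).sym2Map :=
    edgeFinset_fromEdgeSet_regEdges (N := N) (c := c) hc hcW
  refine rcMeasure_real_map_of_wired (rectEmb W N c) hE
    criticalFKIsingParam_mem_Icc two_pos hWne (fun u => mem_barWiredSet_iff_rectTop u) ?_
  intro ω _
  simp only [Set.mem_setOf_eq]
  have h := exists_reachable_map_iff (rectEmb W N c) ω {x₀} {u₀}
  simp only [Set.mem_singleton_iff, exists_eq_left, Set.image_singleton] at h
  exact h

open scoped Classical in
/-- **From the bar domain to the free rectangle.** For `x` in the rectangle,
`P_bar(x ↔ bar) ≤ 8 ∑_{j<4} φ⁰_R(x ↔ (c+j, N))` (exit decomposition, domination by the wired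
measure of `R`, and the cost `q³ = 8` of un-wiring the four sites under the bar).
[cite: DuminilCopinHonglerNolin2011, §4, proof of Proposition 13] -/
theorem fkDobrushin_openJoined_le_sum_free (hc : 0 ≤ c) (hcW : c + 3 ≤ W) (x₀ : RectV W N)
    (u : Fin 4 → RectV W N) (hu : ∀ j, rectEmb W N c (u j) = topSite W N c hc hcW j) :
    (fkDobrushinMeasure (barD W N c)).real {ω | (barD W N c).OpenJoinedToArcA (rectEmb W N c x₀) ω} ≤
      8 * ∑ j : Fin 4, (fkIsingFiniteMeasure (Percolation.rectangle W N) ∅).real {θ | (fromEdgeSet θ).Reachable x₀ (u j)} := by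
  rw [fkDobrushin_real_openJoined_eq hc hcW, Finset.mul_sum]
  refine (rcMeasure_openJoined_le_sum hc hcW _ (isReg_rectEmb x₀)).trans (Finset.sum_le_sum fun j _ => ?_)
  rw [← hu j, rcMeasure_regEdges_reachable_eq hc hcW x₀ (u j)]
  have h8 := rcMeasure_real_wired_le_pow_mul_free ((zdGraph 2).induce ((Percolation.rectangle W N : Finset (Site 2)) : Set (Site 2)))
    criticalFKIsingParam_mem_Icc (by norm_num : (1 : ℝ) ≤ 2) (rectTop W N c) {θ | (fromEdgeSet θ).Reachable x₀ (u j)}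
  rw [card_rectTop hc hcW] at h8
  norm_num at h8
  exact h8

end LatticeDobrushin

end Literature.Probability.LatticeModels
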